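import Literature.Barriers.BirchSwinnertonDyer.RankNotSumOfLocalInvariantsWeakSubfieldBoundsProofs
import Literature.NumberTheory.EllipticCurves.TwoDescentNormKernel
import HarnessLib

/-!
# Barrier (BirchSwinnertonDyer), rank mod `3`: the `n = 3` fact from the norm-`1` part of the four cubic `2`-descents

Towards the named fact `Literature.Barriers.BirchSwinnertonDyer.DokchitserDokchitser2011_rank_480a1_F3`
(`RankNotSumOfLocalInvariantsProofs.lean`): "`F₃` = the degree 9 subfield of `ℚ(ζ₁₃, ζ₁₀₃)` […]
2-descent shows that `rk E/F₃ = 1` (e.g. using Magma, over all minimal non-trivial subfields of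
`F_n`)" for `E = 480a1 : y² = x(x+2)(x-3)`, proof of Theorem 2 of T. Dokchitser–V. Dokchitser,
*A note on the Mordell–Weil rank modulo `n`*, J. Number Theory 131 (2011) 1833–1839
(arXiv:0910.4588). The tree has: the field `F₃` and its splitting
(`RankNotSumOfLocalInvariantsF3.lean`), the reduction to the four cubic subfields
`K_σ = F₃^{⟨σ⟩}` with the weak bound `rk E(K_σ) ≤ 2`
(`RankNotSumOfLocalInvariantsF3Cubic.lean`, `…WeakSubfieldBoundsProofs.lean`), and `rk E(ℚ) = 1`
by a complete `2`-descent over `ℚ` carried out in Lean (`…480a1RankProofs.lean`). This file adds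
the last piece of ALGEBRA between those and the four descents: by the odd-degree `2`-descent
theorem `WeierstrassCurve.mordellWeilRank_baseChange_eq_of_odd_of_twoDescent_norm`
(`Literature/NumberTheory/EllipticCurves/TwoDescentNormKernel.lean`: for `K/ℚ` Galois of odd
degree, `rk E(K) = rk E(ℚ)` as soon as the norm-`1` classes in the `2`-Selmer image of `E(K)` are
trivial), the fact follows from a purely diophantine statement about each cubic field `K_σ`:

> every `(x, y) ∈ E(K_σ)` with `x ≠ 0, -2, 3` such that `N_{K_σ/ℚ}(x)` and `N_{K_σ/ℚ}(x + 2)` are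
> rational squares has `x` and `x + 2` squares in `K_σ`

(`DokchitserDokchitser2011_rank_480a1_F3_of_cubic_normDescent`). Compared with the earlier
reductions (`rk E(K_σ) ≤ 1`, resp. `≤ 2`, i.e. a bound for the whole `2`-Selmer group of `E/K_σ`),
only the NEW part of the Selmer image over `K_σ` is concerned, and the two norm conditions are
available as hypotheses: at a prime of `K_σ` inert over `ℚ` they already force `x`, `x + 2` to
have even valuation.

| statement | declaration | status |
|---|---|---|
| `2`-torsion of `480a1` rational over any `K ⊇ ℚ` | `curve480a1.splitTwoTorsion_baseChange` | proved |
| `K/ℚ` Galois of odd degree + norm-`1` descent statement ⟹ `rk E(K) = 1` | `curve480a1.mordellWeilRank_baseChange_eq_one_of_odd_of_normDescent` | proved |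
| the same for `K = K_σ ⊂ F₃`, `σ ≠ 1` | `DokchitserDokchitser2011.F₃.mordellWeilRank_curve480a1_cubicField_eq_one_of_normDescent` | proved |
| norm-`1` descent statements over the four `K_σ` ⟹ `DokchitserDokchitser2011_rank_480a1_F3` | `DokchitserDokchitser2011_rank_480a1_F3_of_cubic_normDescent` | proved |
| the four norm-`1` descent statements (cyclic cubic fields of conductor `13, 103, 1339, 1339`: units and class-number parity of `K_σ`, local images at the primes above `2, 3, 5`) | hypothesis `h` | NOT formalised; no new named fact (the debt stays with `DokchitserDokchitser2011_rank_480a1_F3`) |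

## Design notes

Theorems only (no definitions, no named facts; D-0026). The cubic subfields and their Galois
property are handled exactly as in `RankNotSumOfLocalInvariantsWeakSubfieldBoundsProofs.lean`
(`IsGalois.of_fixedField_normal_subgroup` under `IsAbelianGalois ℚ F₃`, elaborated with
`set_option backward.isDefEq.respectTransparency false` across the `ℚ`-algebra instance diamond
on intermediate fields of `Cyclotomic1339`).

## References

* T. Dokchitser, V. Dokchitser, *A note on the Mordell–Weil rank modulo `n`*, J. Number Theory 131
  (2011) 1833–1839, arXiv:0910.4588: proof of Thm. 2 (p. 3 of the held arXiv copy).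
  [DokchitserDokchitser2011RankModN]
* J. H. Silverman, *The Arithmetic of Elliptic Curves*, 2nd ed., GTM 106 (2009), Prop. X.1.4,
  Thm. VIII.6.7. [SilvermanAEC2009]
-/

noncomputable section

open scoped Classical NumberField

open NumberField WeierstrassCurve WeierstrassCurve.Affine WeierstrassCurve.Affine.Point
  IntermediateField

namespace Literature.Barriers.BirchSwinnertonDyer

namespace curve480a1

/-- The `2`-torsion of `480a1 : y² = x(x+2)(x-3)` stays rational over every field `K ⊇ ℚ`:
`e₁ = 0, e₂ = -2, e₃ = 3` (as images of rationals, the form consumed by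
`WeierstrassCurve.mordellWeilRank_baseChange_eq_of_odd_of_twoDescent_norm`). [folklore] -/
theorem splitTwoTorsion_baseChange (K : Type) [Field K] [CharZero K] [Algebra ℚ K] :
    (curve480a1.baseChange K).toAffine.SplitTwoTorsion (algebraMap ℚ K 0) (algebraMap ℚ K (-2))
      (algebraMap ℚ K 3) := by
  rw [_root_.map_zero, map_neg, map_ofNat]
  constructor
  · show (curve480a1.map (algebraMap ℚ K)).b₂ = _
    rw [map_b₂]
    norm_num [curve480a1, WeierstrassCurve.b₂]
  · show (curve480a1.map (algebraMap ℚ K)).b₄ = _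
    rw [map_b₄]
    norm_num [curve480a1, WeierstrassCurve.b₄]
  · show (curve480a1.map (algebraMap ℚ K)).b₆ = _
    rw [map_b₆]
    norm_num [curve480a1, WeierstrassCurve.b₆]

/-- **`rk E(K) = 1` for `E = 480a1` over a Galois number field `K` of odd degree, from the
norm-`1` part of the `2`-descent over `K`.** If for every `(x, y) ∈ E(K)` with `x ≠ 0, -2, 3`
such that `N_{K/ℚ}(x)` and `N_{K/ℚ}(x + 2)` are rational squares, `x` and `x + 2` are squares
in `K`, then `rank_ℤ E(K) = rank_ℤ E(ℚ) = 1`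
(`WeierstrassCurve.mordellWeilRank_baseChange_eq_of_odd_of_twoDescent_norm` and the complete
`2`-descent over `ℚ`, `curve480a1.mordellWeilRank_eq_one`). [folklore] -/
theorem mordellWeilRank_baseChange_eq_one_of_odd_of_normDescent (K : Type) [Field K]
    [NumberField K] [Algebra ℚ K] [IsGalois ℚ K] (hodd : Odd (Module.finrank ℚ K))
    (h : ∀ x y : K, (curve480a1.baseChange K).toAffine.Nonsingular x y →
      x ≠ 0 → x ≠ -2 → x ≠ 3 → IsSquare (Algebra.norm ℚ x) → IsSquare (Algebra.norm ℚ (x + 2)) →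
      IsSquare x ∧ IsSquare (x + 2)) :
    (curve480a1.baseChange K).mordellWeilRank = 1 := by
  have key := curve480a1.mordellWeilRank_baseChange_eq_of_odd_of_twoDescent_norm K hodd 0 (-2) 3
    (splitTwoTorsion_baseChange K) fun x y hxy h₁ h₂ h₃ hn₁ hn₂ => by
      simp only [_root_.map_zero, map_neg, map_ofNat, sub_zero, sub_neg_eq_add] at h₁ h₂ h₃ hn₁ hn₂ ⊢
      exact h x y hxy h₁ h₂ h₃ hn₁ hn₂
  rw [key, curve480a1.mordellWeilRank_eq_one]

end curve480a1

namespace DokchitserDokchitser2011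

open Cyclotomic1339

set_option backward.isDefEq.respectTransparency false in
/-- **`rk E(K_σ) = 1` over a cubic subfield of `F₃` from the norm-`1` part of its
`2`-descent.** For `E = 480a1` and a cubic subfield `K_σ = F₃^{⟨σ⟩}` (`σ ≠ 1`) of the degree-`9`
field `F₃ ⊂ ℚ(ζ₁₃₃₉)` (`Gal(K_σ/ℚ) ≅ C₃`, as `F₃/ℚ` is abelian): if for every
`(x, y) ∈ E(K_σ)` with `x ≠ 0, -2, 3` whose `N_{K_σ/ℚ}(x)` and `N_{K_σ/ℚ}(x + 2)` are rational
squares the elements `x`, `x + 2` are squares in `K_σ`, then `rk_ℤ E(K_σ) = 1`. This is the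
part of "2-descent […] over all minimal non-trivial subfields" (proof of Thm. 2) that goes beyond
the descent over `ℚ` (`rk E(ℚ) = 1`, proved in the tree).
[cite: DokchitserDokchitser2011RankModN, proof of Thm. 2] -/
theorem F₃.mordellWeilRank_curve480a1_cubicField_eq_one_of_normDescent {σ : Gal(F₃/ℚ)}
    (hσ : σ ≠ 1)
    (h : ∀ x y : F₃.cubicField σ,
      (curve480a1.baseChange (F₃.cubicField σ)).toAffine.Nonsingular x y →
      x ≠ 0 → x ≠ -2 → x ≠ 3 → IsSquare (Algebra.norm ℚ x) → IsSquare (Algebra.norm ℚ (x + 2)) →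
      IsSquare x ∧ IsSquare (x + 2)) :
    (curve480a1.baseChange (F₃.cubicField σ)).mordellWeilRank = 1 := by
  haveI : IsAbelianGalois ℚ F₃ := inferInstance
  haveI : IsGalois ℚ (F₃.cubicField σ) :=
    IsGalois.of_fixedField_normal_subgroup (Subgroup.zpowers σ)
  have hodd : Odd (Module.finrank ℚ (F₃.cubicField σ)) := by
    rw [F₃.finrank_cubicField hσ]
    exact ⟨1, rfl⟩
  exact curve480a1.mordellWeilRank_baseChange_eq_one_of_odd_of_normDescent (F₃.cubicField σ) hodd h

end DokchitserDokchitser2011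

open DokchitserDokchitser2011 in
/-- **The `n = 3` fact of Dokchitser–Dokchitser 2011 from the norm-`1` parts of the four cubic
`2`-descents.** The tree's named fact `DokchitserDokchitser2011_rank_480a1_F3` ("the degree 9
subfield `F₃` of `ℚ(ζ₁₃, ζ₁₀₃)` […] 2-descent shows that `rk E/F₃ = 1` (e.g. using Magma, over
all minimal non-trivial subfields)") follows from the following statement about each of the four
cubic subfields `K_σ ⊂ F₃` alone: every point `(x, y) ∈ E(K_σ)`, `x ≠ 0, -2, 3`, with
`N_{K_σ/ℚ}(x)` and `N_{K_σ/ℚ}(x + 2)` rational squares has `x` and `x + 2` squares in `K_σ` —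
i.e. the classes of norm `1` in the `2`-Selmer image of `E(K_σ)` are trivial. (Then
`rk E(K_σ) = 1` for all four, `F₃.mordellWeilRank_curve480a1_cubicField_eq_one_of_normDescent`,
and the `C₃ × C₃` descent `DokchitserDokchitser2011_rank_480a1_F3_of_cubic_le_two` concludes.)
What remains open towards `…_rank_480a1_F3_holds` is exactly this diophantine statement over
the cyclic cubic fields of conductors `13`, `103`, `1339`, `1339`.
[cite: DokchitserDokchitser2011RankModN, proof of Thm. 2] -/
theorem DokchitserDokchitser2011_rank_480a1_F3_of_cubic_normDescent
    (h : ∀ σ : Gal(F₃/ℚ), σ ≠ 1 → ∀ x y : F₃.cubicField σ,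
      (curve480a1.baseChange (F₃.cubicField σ)).toAffine.Nonsingular x y →
      x ≠ 0 → x ≠ -2 → x ≠ 3 → IsSquare (Algebra.norm ℚ x) → IsSquare (Algebra.norm ℚ (x + 2)) →
      IsSquare x ∧ IsSquare (x + 2)) :
    DokchitserDokchitser2011_rank_480a1_F3 :=
  DokchitserDokchitser2011_rank_480a1_F3_of_cubic_le_two fun σ hσ =>
    (F₃.mordellWeilRank_curve480a1_cubicField_eq_one_of_normDescent hσ (h σ hσ)).le.trans
      one_le_two

end Literature.Barriers.BirchSwinnertonDyer

end
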